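import Summits.QuantumFields.YangMills.Theorems.BalabanUVNodesN21AxialCombDictionary

/-!
# N21 (NE7c) · THE BOND DICTIONARY AT pub-balaban's AXIAL COMB, PART II: the (1.9) binder of the (M1) ENDs on the block
# chart of the OFF-COMB bonds of a non-wrapping torus box `[lo, hi]`, from the (1.7) row — dictionary SUPPLIED, not
# displayed (file 10b of WIDTH-209 N21 piece 2)

Width seat pub-ymgap-dag-n21-w3 (g5), node N21 = NE7c (NOT PRINTED, NOT proved), lane K3⁸ `SpineGivenEndpointR13SepCoPHV`
(stmt-QuantumFields-27366, `--kind proof --supports … --as helper`; K3⁷ 20544 = aside ∕ lineage).  Imports part I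
`…N21AxialCombDictionary` (the `castBond` dictionary: `ℤ^d` box ∕ comb of `B16Eq18Proof` ↔ pub-balaban's `boxBonds` ∕
`combBonds`; the off-comb block `castBond '' (innerBonds ∖ treeBonds) = boxBonds lo hi ∖ combSet lo hi`).

WHY.  Files 7 ∕ 9 display the bond dictionary `e` as a datum; at the lane's own tree-gauge letters (`T := combBonds lo hi`,
blocks of box bonds off the comb — dag-n21-w2's junctions №4 ∕ №5, dag-n21-w1 g3's `N21WindowLetterAlgebra` §1b) the block IS
the off-comb block of part I, and the ENDs' coercivity binder `h19` can be read from print's (1.7) row with NOTHING displayed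
but the row, the side clause and the smallness line: the chart vector is extended by zero to all torus bonds and pulled back
to `ℤ^d` along `castBond`, and (1.8) for the box (`B16Eq18Proof.ineq18_box_vec`) + `B16Sect1Wilson.ineq19_of_17_18` do the rest.

WHAT (THEOREMS ONLY; 0 `def`, 0 `sorry`).
* §4 ★★ `ineq19_blockChartSU_image_of_ineq17` (any `ℤ^d` box with `castBond` injective on its inner bonds) ∕
  ★★ `ineq19_blockChartSU_offComb_of_ineq17` (the non-wrapping `[lo, hi]`): on `BlockChartSU N (castBond '' off-tree)` the
  (1.7) row — asked of the quadratic member against the curl energy of the chart vector EXTENDED BY ZERO to all torus bonds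
  and PULLED BACK along `castBond` — plus `1 ≤ d`, sides `≤ 100M` (`hi_κ + 1 − lo_κ ≤ 100M`), `1 ≤ M`, `0 ≤ γ₀` and the
  smallness line ⇒ `∀ v, Ineq19 (Qf v) (Σ_{b′} ‖v b′‖²) γ₀ d M`.  No `e`, no `∃ b`: every object is named.
* §5 ★★ `convexOn_blockChartSU_offComb_expansion_of_ineq17_analyticSupBound`: file 5-local's ★★′-loc on that block chart
  with `h19` discharged by §4.
* §6 A6 `ineq17_binders_inhabited_offComb`: §4's binder list jointly inhabited NON-TRIVIALLY on every non-wrapping box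
  (`Qf :=` the curl energy, `γ₀ = 1`, `C = 0`), §4 then returning the rescaled (1.8) on the off-comb block chart.

HONEST FRAMING.  [folklore] bookkeeping + three tree theorems BY NAME (`B16Eq18Proof.ineq18_box_vec`,
`B16Sect1Wilson.ineq19_of_17_18`, file 5-local); (1.7) stays a DISPLAYED ROW about NODE O's `Δ₁(ζ₀)`, NOT asserted; WHICH
box `[lo, hi]` the lane's (M1) package fixes (dag-n21-w2 ∕ dag-n21-d) and the identification of an END's `Qf` with
⟨H_{1,k}B′, Δ₁(ζ₀)H_{1,k}B′⟩ are LOCATED typing; nothing of Bałaban's asserted; (M1) ∕ NE7c NOT PRINTED ∕ NOT proved; N21 NOT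
discharged; K3⁸ NOT claimed; counts unmoved (typed 28∕28 · discharged 5∕27); count-neutral; one finite 𝕋⁴ at fixed ε — the
Yang–Mills mass gap (Clay) is NOT proved by any of this: R4 closes the conditional finite-𝕋⁴ rung `BalabanLadder.UV` only;
nothing continuum ∕ ℝ⁴ ∕ OS.
-/

set_option autoImplicit false

noncomputable section

open Set Function Finset Matrix Metric

namespace Summit.QuantumFields.YangMills.Theorems.N21ChartExponentCoercivityAxialComb

open Literature.MathematicalPhysics.QuantumFieldTheory.Balaban1983to89
open Literature.MathematicalPhysics.QuantumFieldTheory.Balaban1983to89.B16Sect1Wilson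
  (Ineq17 Ineq18 Ineq19 ineq19_of_17_18)
open Literature.MathematicalPhysics.QuantumFieldTheory.Balaban1983to89.B6TreeGaugePoincare (Cfg curl)
open Literature.MathematicalPhysics.QuantumFieldTheory.Balaban1983to89.B16Eq18Proof
  (box mem_box treeBonds mem_treeBonds innerBonds mem_innerBonds innerPlaq treeBonds_subset_innerBonds ineq18_box_vec)
open Literature.MathematicalPhysics.QuantumFieldTheory.Balaban1983to89.T4AxialGaugeSmallField (castSite)
open Summit.QuantumFields.BalabanUV.T4Continuum.ShellMeasureExpChartSUN (BlockChartSU dimSU)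
open Summit.QuantumFields.YangMills.Theorems.N21LowCentreEndAtSUNBlockChart (sum_sq_flatten)
open Summit.QuantumFields.YangMills.Theorems.N21ChartExponentConvexityLocalSUN
  (convexOn_blockChartSU_expansion_of_analyticSupBound_local)
open Summit.QuantumFields.YangMills.Theorems.N21AxialCombDictionary
  (castBond_injOn_innerBonds sides_le_of_le)

variable {P : Params} {j : ℕ}

/-! ## §4  ★★ The (1.9) binder on the block chart of the off-comb bonds from the (1.7) row — no dictionary displayed -/

section Coercivity

variable {N : ℕ}

/-- ★★ (general box form) **(1.9) ON `BlockChartSU N (castBond '' (innerBonds n y ∖ treeBonds n y))` FROM (1.7) + PROVED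
(1.8)**, for any `ℤ^d` box `box n y` (sides `n_κ ≤ 100M`, `1 ≤ M`) on whose inner bonds `castBond` is INJECTIVE (e.g. a
non-wrapping box, `castBond_injOn_innerBonds`).  The chart vector is extended by ZERO to all torus bonds and pulled back
along `castBond` (`bd ↦ v ⟨castBond bd⟩` if `castBond bd` is in the block, else `0`); the (1.7) row is asked against that
configuration's curl energy over the box's plaquettes and `Σ_{b′} ‖v b′‖²`. [cite: Balaban1989LargeFieldII, (1.7)–(1.9) p.358] [folklore] -/
theorem ineq19_blockChartSU_image_of_ineq17 {n : Fin P.d → ℕ} {y : Fin P.d → ℤ}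
    (hinj : Set.InjOn (fun bd : (Fin P.d → ℤ) × Fin P.d => (⟨castSite bd.1, bd.2⟩ : PBond P j)) ↑(innerBonds n y))
    (M : ℕ) (hd : 1 ≤ P.d) (hnM : ∀ κ, n κ ≤ 100 * M) (hM : 1 ≤ M)
    (Qf : BlockChartSU N ((innerBonds n y \ treeBonds n y).image
          fun bd : (Fin P.d → ℤ) × Fin P.d => (⟨castSite bd.1, bd.2⟩ : PBond P j)) → ℝ)
    {γ₀ C Rk εk : ℝ} (hγ : 0 ≤ γ₀)
    (h17 : ∀ v : BlockChartSU N ((innerBonds n y \ treeBonds n y).image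
          fun bd : (Fin P.d → ℤ) × Fin P.d => (⟨castSite bd.1, bd.2⟩ : PBond P j)),
      Ineq17 (Qf v)
        (∑ p ∈ innerPlaq n y, ∑ a : Fin (dimSU N),
          curl (fun bd => if h : (⟨castSite bd.1, bd.2⟩ : PBond P j) ∈ (innerBonds n y \ treeBonds n y).image
                fun bd' : (Fin P.d → ℤ) × Fin P.d => (⟨castSite bd'.1, bd'.2⟩ : PBond P j)
            then v ⟨(⟨castSite bd.1, bd.2⟩ : PBond P j), h⟩ a else (0 : ℝ)) p.1 p.2.1 p.2.2 ^ 2)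
        (∑ i, ‖v i‖ ^ 2) γ₀ C M Rk εk)
    (hsmall : C * ((M : ℝ) ^ 6 * Rk * εk + Real.exp (-Rk)) ≤ γ₀ / (2 * P.d * (100 * (M : ℝ)) ^ (P.d + 1))) :
    ∀ v : BlockChartSU N ((innerBonds n y \ treeBonds n y).image
          fun bd : (Fin P.d → ℤ) × Fin P.d => (⟨castSite bd.1, bd.2⟩ : PBond P j)),
      Ineq19 (Qf v) (∑ i, ‖v i‖ ^ 2) γ₀ P.d M := by
  classical
  intro v
  have hM' : (0 : ℝ) < (M : ℝ) := by exact_mod_cast hM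
  have hnB : (0 : ℝ) ≤ ∑ i, ‖v i‖ ^ 2 := Finset.sum_nonneg fun i _ => sq_nonneg _
  have hinjS : Set.InjOn (fun bd : (Fin P.d → ℤ) × Fin P.d => (⟨castSite bd.1, bd.2⟩ : PBond P j))
      ↑(innerBonds n y \ treeBonds n y) :=
    hinj.mono (Finset.coe_subset.2 Finset.sdiff_subset)
  -- a tree bond's image is no off-tree bond's image
  have hnot : ∀ bd ∈ treeBonds n y, (⟨castSite bd.1, bd.2⟩ : PBond P j) ∉ (innerBonds n y \ treeBonds n y).image
      fun bd' : (Fin P.d → ℤ) × Fin P.d => (⟨castSite bd'.1, bd'.2⟩ : PBond P j) := by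
    intro bd hbd h
    obtain ⟨bd', hbd', hEq⟩ := Finset.mem_image.1 h
    have h1 : bd' ∈ innerBonds n y := (mem_sdiff.1 hbd').1
    have := hinj (Finset.mem_coe.2 h1) (Finset.mem_coe.2 (treeBonds_subset_innerBonds y hbd)) hEq
    exact (mem_sdiff.1 hbd').2 (this ▸ hbd)
  -- the pulled-back configuration vanishes on the comb tree
  have htree : ∀ bd ∈ treeBonds n y,
      (fun a : Fin (dimSU N) => if h : (⟨castSite bd.1, bd.2⟩ : PBond P j) ∈ (innerBonds n y \ treeBonds n y).image
            fun bd' : (Fin P.d → ℤ) × Fin P.d => (⟨castSite bd'.1, bd'.2⟩ : PBond P j)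
        then v ⟨(⟨castSite bd.1, bd.2⟩ : PBond P j), h⟩ a else (0 : ℝ)) = 0 := by
    intro bd hbd
    funext a
    simp only [dif_neg (hnot bd hbd), Pi.zero_apply]
  -- its sum of squares over the box's inner bonds is `Σ_{b′} ‖v b′‖²`
  have hsq : ∑ bd ∈ innerBonds n y, ∑ a : Fin (dimSU N),
      (if h : (⟨castSite bd.1, bd.2⟩ : PBond P j) ∈ (innerBonds n y \ treeBonds n y).image
            fun bd' : (Fin P.d → ℤ) × Fin P.d => (⟨castSite bd'.1, bd'.2⟩ : PBond P j)
        then v ⟨(⟨castSite bd.1, bd.2⟩ : PBond P j), h⟩ a else (0 : ℝ)) ^ 2 = ∑ i, ‖v i‖ ^ 2 := by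
    rw [← sum_sdiff (treeBonds_subset_innerBonds (n := n) y)]
    have hT : ∑ bd ∈ treeBonds n y, ∑ a : Fin (dimSU N),
        (if h : (⟨castSite bd.1, bd.2⟩ : PBond P j) ∈ (innerBonds n y \ treeBonds n y).image
              fun bd' : (Fin P.d → ℤ) × Fin P.d => (⟨castSite bd'.1, bd'.2⟩ : PBond P j)
          then v ⟨(⟨castSite bd.1, bd.2⟩ : PBond P j), h⟩ a else (0 : ℝ)) ^ 2 = 0 := by
      refine sum_eq_zero fun bd hbd => sum_eq_zero fun a _ => ?_
      rw [dif_neg (hnot bd hbd)]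
      ring
    rw [hT, add_zero]
    -- re-index the off-tree part over the block through the injective `castBond`
    have hoff := (Finset.sum_image
      (f := fun x : PBond P j => ∑ a : Fin (dimSU N),
        (if h : x ∈ (innerBonds n y \ treeBonds n y).image
              fun bd' : (Fin P.d → ℤ) × Fin P.d => (⟨castSite bd'.1, bd'.2⟩ : PBond P j)
          then v ⟨x, h⟩ a else (0 : ℝ)) ^ 2) hinjS).symm
    rw [hoff, ← sum_sq_flatten _ v, Fintype.sum_prod_type,
      ← Finset.sum_coe_sort ((innerBonds n y \ treeBonds n y).image
        fun bd' : (Fin P.d → ℤ) × Fin P.d => (⟨castSite bd'.1, bd'.2⟩ : PBond P j))]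
    refine sum_congr rfl fun i _ => sum_congr rfl fun a _ => ?_
    simp only [dif_pos i.2]
  have h18raw := ineq18_box_vec (D := dimSU N) M hM hnM y
    (fun (bd : (Fin P.d → ℤ) × Fin P.d) (a : Fin (dimSU N)) =>
      if h : (⟨castSite bd.1, bd.2⟩ : PBond P j) ∈ (innerBonds n y \ treeBonds n y).image
            fun bd' : (Fin P.d → ℤ) × Fin P.d => (⟨castSite bd'.1, bd'.2⟩ : PBond P j)
        then v ⟨(⟨castSite bd.1, bd.2⟩ : PBond P j), h⟩ a else (0 : ℝ)) htree
  rw [hsq] at h18raw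
  exact ineq19_of_17_18 hd hM' hγ hnB (h17 v) h18raw hsmall

variable {lo hi : Fin P.d → ℤ}

/-- ★★ **(1.9) ON THE BLOCK CHART OF THE OFF-COMB BONDS OF A NON-WRAPPING TORUS BOX `[lo, hi]` FROM (1.7) + PROVED (1.8).**
Extend a chart vector `v` on the off-comb block `castBond '' (innerBonds ∖ treeBonds)` (= `boxBonds lo hi ∖ combSet lo hi`,
§2) by ZERO to all torus bonds and pull it back along `castBond`.  If the quadratic member obeys print's (1.7) row against
that configuration's curl energy over the box's plaquettes and `Σ_{b′} ‖v b′‖²`, for every `v`, and `1 ≤ d`,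
`hi_κ + 1 − lo_κ ≤ 100M`, `1 ≤ M`, `0 ≤ γ₀`, the smallness line hold, then `∀ v, Ineq19 (Qf v) (Σ ‖v b′‖²) γ₀ d M` — the
ENDs' `h19` with the dictionary SUPPLIED. [cite: Balaban1989LargeFieldII, (1.7)–(1.9) p.358] [folklore] -/
theorem ineq19_blockChartSU_offComb_of_ineq17 (hN : ∀ κ, hi κ - lo κ < P.sitesPerDir j) (M : ℕ) (hd : 1 ≤ P.d)
    (hsides : ∀ κ, hi κ + 1 - lo κ ≤ 100 * M) (hM : 1 ≤ M)
    (Qf : BlockChartSU N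
        ((innerBonds (fun κ => (hi κ + 1 - lo κ).toNat) lo \ treeBonds (fun κ => (hi κ + 1 - lo κ).toNat) lo).image
          fun bd : (Fin P.d → ℤ) × Fin P.d => (⟨castSite bd.1, bd.2⟩ : PBond P j)) → ℝ)
    {γ₀ C Rk εk : ℝ} (hγ : 0 ≤ γ₀)
    (h17 : ∀ v : BlockChartSU N
        ((innerBonds (fun κ => (hi κ + 1 - lo κ).toNat) lo \ treeBonds (fun κ => (hi κ + 1 - lo κ).toNat) lo).image
          fun bd : (Fin P.d → ℤ) × Fin P.d => (⟨castSite bd.1, bd.2⟩ : PBond P j)),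
      Ineq17 (Qf v)
        (∑ p ∈ innerPlaq (fun κ => (hi κ + 1 - lo κ).toNat) lo, ∑ a : Fin (dimSU N),
          curl (fun bd => if h : (⟨castSite bd.1, bd.2⟩ : PBond P j) ∈
              (innerBonds (fun κ => (hi κ + 1 - lo κ).toNat) lo \ treeBonds (fun κ => (hi κ + 1 - lo κ).toNat) lo).image
                fun bd' : (Fin P.d → ℤ) × Fin P.d => (⟨castSite bd'.1, bd'.2⟩ : PBond P j)
            then v ⟨(⟨castSite bd.1, bd.2⟩ : PBond P j), h⟩ a else (0 : ℝ)) p.1 p.2.1 p.2.2 ^ 2)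
        (∑ i, ‖v i‖ ^ 2) γ₀ C M Rk εk)
    (hsmall : C * ((M : ℝ) ^ 6 * Rk * εk + Real.exp (-Rk)) ≤ γ₀ / (2 * P.d * (100 * (M : ℝ)) ^ (P.d + 1))) :
    ∀ v : BlockChartSU N
        ((innerBonds (fun κ => (hi κ + 1 - lo κ).toNat) lo \ treeBonds (fun κ => (hi κ + 1 - lo κ).toNat) lo).image
          fun bd : (Fin P.d → ℤ) × Fin P.d => (⟨castSite bd.1, bd.2⟩ : PBond P j)),
      Ineq19 (Qf v) (∑ i, ‖v i‖ ^ 2) γ₀ P.d M :=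
  ineq19_blockChartSU_image_of_ineq17 (castBond_injOn_innerBonds hN) M hd (sides_le_of_le hsides) hM Qf hγ h17 hsmall

end Coercivity

/-! ## §5  ★★ Convexity of the (1.2)-shaped exponent on the off-comb block chart from the (1.7) row -/

section Convexity

variable {N : ℕ} {lo hi : Fin P.d → ℤ}

/-- ★★ **CONVEXITY ON THE OFF-COMB BLOCK CHART FROM THE (1.7) ROW** = file 5's ★★′-loc
`convexOn_blockChartSU_expansion_of_analyticSupBound_local` with `h19` DISCHARGED by §4 (no dictionary displayed), the
analyticity letter and the clause `4·d·(100M)^{d+1}·S ≤ γ₀·r²` as there. [cite: Balaban1989LargeFieldII, (1.7)–(1.9) p.358] [textbook] -/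
theorem convexOn_blockChartSU_offComb_expansion_of_ineq17_analyticSupBound (hN : ∀ κ, hi κ - lo κ < P.sitesPerDir j)
    (M : ℕ) (hd : 1 ≤ P.d) (hsides : ∀ κ, hi κ + 1 - lo κ ≤ 100 * M) (hM : 1 ≤ M)
    {K : Set (BlockChartSU N
        ((innerBonds (fun κ => (hi κ + 1 - lo κ).toNat) lo \ treeBonds (fun κ => (hi κ + 1 - lo κ).toNat) lo).image
          fun bd : (Fin P.d → ℤ) × Fin P.d => (⟨castSite bd.1, bd.2⟩ : PBond P j)))}
    (hK : Convex ℝ K)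
    (φ Qf lin Vt : BlockChartSU N
        ((innerBonds (fun κ => (hi κ + 1 - lo κ).toNat) lo \ treeBonds (fun κ => (hi κ + 1 - lo κ).toNat) lo).image
          fun bd : (Fin P.d → ℤ) × Fin P.d => (⟨castSite bd.1, bd.2⟩ : PBond P j)) → ℝ)
    (c : ℝ) (hexp : ∀ v ∈ K, φ v = c + 1 / 2 * Qf v + lin v + Vt v)
    (A : Matrix
        (↥((innerBonds (fun κ => (hi κ + 1 - lo κ).toNat) lo \ treeBonds (fun κ => (hi κ + 1 - lo κ).toNat) lo).image
            fun bd : (Fin P.d → ℤ) × Fin P.d => (⟨castSite bd.1, bd.2⟩ : PBond P j)) × Fin (dimSU N))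
        (↥((innerBonds (fun κ => (hi κ + 1 - lo κ).toNat) lo \ treeBonds (fun κ => (hi κ + 1 - lo κ).toNat) lo).image
            fun bd : (Fin P.d → ℤ) × Fin P.d => (⟨castSite bd.1, bd.2⟩ : PBond P j)) × Fin (dimSU N)) ℝ)
    (hQf : ∀ v, Qf v = (fun q => v q.1 q.2) ⬝ᵥ (A *ᵥ fun q => v q.1 q.2))
    {γ₀ C Rk εk : ℝ} (hγ : 0 ≤ γ₀)
    (h17 : ∀ v : BlockChartSU N
        ((innerBonds (fun κ => (hi κ + 1 - lo κ).toNat) lo \ treeBonds (fun κ => (hi κ + 1 - lo κ).toNat) lo).image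
          fun bd : (Fin P.d → ℤ) × Fin P.d => (⟨castSite bd.1, bd.2⟩ : PBond P j)),
      Ineq17 (Qf v)
        (∑ p ∈ innerPlaq (fun κ => (hi κ + 1 - lo κ).toNat) lo, ∑ a : Fin (dimSU N),
          curl (fun bd => if h : (⟨castSite bd.1, bd.2⟩ : PBond P j) ∈
              (innerBonds (fun κ => (hi κ + 1 - lo κ).toNat) lo \ treeBonds (fun κ => (hi κ + 1 - lo κ).toNat) lo).image
                fun bd' : (Fin P.d → ℤ) × Fin P.d => (⟨castSite bd'.1, bd'.2⟩ : PBond P j)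
            then v ⟨(⟨castSite bd.1, bd.2⟩ : PBond P j), h⟩ a else (0 : ℝ)) p.1 p.2.1 p.2.2 ^ 2)
        (∑ i, ‖v i‖ ^ 2) γ₀ C M Rk εk)
    (hsmall : C * ((M : ℝ) ^ 6 * Rk * εk + Real.exp (-Rk)) ≤ γ₀ / (2 * P.d * (100 * (M : ℝ)) ^ (P.d + 1)))
    (ℓ : BlockChartSU N
        ((innerBonds (fun κ => (hi κ + 1 - lo κ).toNat) lo \ treeBonds (fun κ => (hi κ + 1 - lo κ).toNat) lo).image
          fun bd : (Fin P.d → ℤ) × Fin P.d => (⟨castSite bd.1, bd.2⟩ : PBond P j)) →ₗ[ℝ] ℝ)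
    (hlin : ∀ v, lin v = ℓ v)
    (Φ : (↥((innerBonds (fun κ => (hi κ + 1 - lo κ).toNat) lo \ treeBonds (fun κ => (hi κ + 1 - lo κ).toNat) lo).image
            fun bd : (Fin P.d → ℤ) × Fin P.d => (⟨castSite bd.1, bd.2⟩ : PBond P j)) × Fin (dimSU N) → ℂ) → ℂ)
    {r S : ℝ} (hr : 0 < r)
    (hVt : ∀ x ∈ K, Vt x = (Φ fun q => ((x q.1 q.2 : ℝ) : ℂ)).re)
    (hΦd : ∀ x ∈ K, DifferentiableOn ℂ Φ (ball (fun q => ((x q.1 q.2 : ℝ) : ℂ)) r))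
    (hΦS : ∀ x ∈ K, ∀ u ∈ ball (fun q => ((x q.1 q.2 : ℝ) : ℂ)) r, ‖Φ u‖ ≤ S)
    (hclause : 4 * P.d * (100 * (M : ℝ)) ^ (P.d + 1) * S ≤ γ₀ * r ^ 2) :
    ConvexOn ℝ K φ :=
  convexOn_blockChartSU_expansion_of_analyticSupBound_local _ hK φ Qf lin Vt c hexp A hQf hd (by exact_mod_cast hM)
    (ineq19_blockChartSU_offComb_of_ineq17 hN M hd hsides hM Qf hγ h17 hsmall) ℓ hlin Φ hr hVt hΦd hΦS hclause

end Convexity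

/-! ## §6  A6: §4's binder list is jointly inhabited on every non-wrapping box — non-trivially -/

section Witness

variable {N : ℕ} {lo hi : Fin P.d → ℤ}

/-- **A6** for ★★ `ineq19_blockChartSU_offComb_of_ineq17`: on every non-wrapping box its hypotheses are jointly inhabited
NON-TRIVIALLY — take for the quadratic member the curl energy of the pulled-back chart vector itself (`γ₀ = 1`, `C = 0`:
the (1.7) row with equality, the smallness line `0 ≤ …`); ★★ then returns the rescaled (1.8) on the off-comb block chart:
`Σ_{b′}‖v b′‖² ∕ (2d(100M)^{d+1}) ≤` that curl energy, for every `v`. [folklore] -/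
theorem ineq17_binders_inhabited_offComb (hN : ∀ κ, hi κ - lo κ < P.sitesPerDir j) (M : ℕ) (hd : 1 ≤ P.d)
    (hsides : ∀ κ, hi κ + 1 - lo κ ≤ 100 * M) (hM : 1 ≤ M) (Rk εk : ℝ) :
    (∀ v : BlockChartSU N
        ((innerBonds (fun κ => (hi κ + 1 - lo κ).toNat) lo \ treeBonds (fun κ => (hi κ + 1 - lo κ).toNat) lo).image
          fun bd : (Fin P.d → ℤ) × Fin P.d => (⟨castSite bd.1, bd.2⟩ : PBond P j)),
      Ineq17
        (∑ p ∈ innerPlaq (fun κ => (hi κ + 1 - lo κ).toNat) lo, ∑ a : Fin (dimSU N),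
          curl (fun bd => if h : (⟨castSite bd.1, bd.2⟩ : PBond P j) ∈
              (innerBonds (fun κ => (hi κ + 1 - lo κ).toNat) lo \ treeBonds (fun κ => (hi κ + 1 - lo κ).toNat) lo).image
                fun bd' : (Fin P.d → ℤ) × Fin P.d => (⟨castSite bd'.1, bd'.2⟩ : PBond P j)
            then v ⟨(⟨castSite bd.1, bd.2⟩ : PBond P j), h⟩ a else (0 : ℝ)) p.1 p.2.1 p.2.2 ^ 2)
        (∑ p ∈ innerPlaq (fun κ => (hi κ + 1 - lo κ).toNat) lo, ∑ a : Fin (dimSU N),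
          curl (fun bd => if h : (⟨castSite bd.1, bd.2⟩ : PBond P j) ∈
              (innerBonds (fun κ => (hi κ + 1 - lo κ).toNat) lo \ treeBonds (fun κ => (hi κ + 1 - lo κ).toNat) lo).image
                fun bd' : (Fin P.d → ℤ) × Fin P.d => (⟨castSite bd'.1, bd'.2⟩ : PBond P j)
            then v ⟨(⟨castSite bd.1, bd.2⟩ : PBond P j), h⟩ a else (0 : ℝ)) p.1 p.2.1 p.2.2 ^ 2)
        (∑ i, ‖v i‖ ^ 2) 1 0 M Rk εk) ∧
    (0 : ℝ) * ((M : ℝ) ^ 6 * Rk * εk + Real.exp (-Rk)) ≤ 1 / (2 * P.d * (100 * (M : ℝ)) ^ (P.d + 1)) ∧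
    ∀ v : BlockChartSU N
        ((innerBonds (fun κ => (hi κ + 1 - lo κ).toNat) lo \ treeBonds (fun κ => (hi κ + 1 - lo κ).toNat) lo).image
          fun bd : (Fin P.d → ℤ) × Fin P.d => (⟨castSite bd.1, bd.2⟩ : PBond P j)),
      Ineq19
        (∑ p ∈ innerPlaq (fun κ => (hi κ + 1 - lo κ).toNat) lo, ∑ a : Fin (dimSU N),
          curl (fun bd => if h : (⟨castSite bd.1, bd.2⟩ : PBond P j) ∈
              (innerBonds (fun κ => (hi κ + 1 - lo κ).toNat) lo \ treeBonds (fun κ => (hi κ + 1 - lo κ).toNat) lo).image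
                fun bd' : (Fin P.d → ℤ) × Fin P.d => (⟨castSite bd'.1, bd'.2⟩ : PBond P j)
            then v ⟨(⟨castSite bd.1, bd.2⟩ : PBond P j), h⟩ a else (0 : ℝ)) p.1 p.2.1 p.2.2 ^ 2)
        (∑ i, ‖v i‖ ^ 2) 1 P.d M := by
  have h17 : ∀ v : BlockChartSU N
        ((innerBonds (fun κ => (hi κ + 1 - lo κ).toNat) lo \ treeBonds (fun κ => (hi κ + 1 - lo κ).toNat) lo).image
          fun bd : (Fin P.d → ℤ) × Fin P.d => (⟨castSite bd.1, bd.2⟩ : PBond P j)),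
      Ineq17
        (∑ p ∈ innerPlaq (fun κ => (hi κ + 1 - lo κ).toNat) lo, ∑ a : Fin (dimSU N),
          curl (fun bd => if h : (⟨castSite bd.1, bd.2⟩ : PBond P j) ∈
              (innerBonds (fun κ => (hi κ + 1 - lo κ).toNat) lo \ treeBonds (fun κ => (hi κ + 1 - lo κ).toNat) lo).image
                fun bd' : (Fin P.d → ℤ) × Fin P.d => (⟨castSite bd'.1, bd'.2⟩ : PBond P j)
            then v ⟨(⟨castSite bd.1, bd.2⟩ : PBond P j), h⟩ a else (0 : ℝ)) p.1 p.2.1 p.2.2 ^ 2)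
        (∑ p ∈ innerPlaq (fun κ => (hi κ + 1 - lo κ).toNat) lo, ∑ a : Fin (dimSU N),
          curl (fun bd => if h : (⟨castSite bd.1, bd.2⟩ : PBond P j) ∈
              (innerBonds (fun κ => (hi κ + 1 - lo κ).toNat) lo \ treeBonds (fun κ => (hi κ + 1 - lo κ).toNat) lo).image
                fun bd' : (Fin P.d → ℤ) × Fin P.d => (⟨castSite bd'.1, bd'.2⟩ : PBond P j)
            then v ⟨(⟨castSite bd.1, bd.2⟩ : PBond P j), h⟩ a else (0 : ℝ)) p.1 p.2.1 p.2.2 ^ 2)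
        (∑ i, ‖v i‖ ^ 2) 1 0 M Rk εk := by
    intro v
    unfold Ineq17
    simp
  have hsmall : (0 : ℝ) * ((M : ℝ) ^ 6 * Rk * εk + Real.exp (-Rk)) ≤ 1 / (2 * P.d * (100 * (M : ℝ)) ^ (P.d + 1)) := by
    rw [zero_mul]
    have hd0 : (0 : ℝ) < P.d := by exact_mod_cast hd
    have hM0 : (0 : ℝ) < M := by exact_mod_cast hM
    positivity
  exact ⟨h17, hsmall, ineq19_blockChartSU_offComb_of_ineq17 hN M hd hsides hM _ zero_le_one h17 hsmall⟩

end Witness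

end Summit.QuantumFields.YangMills.Theorems.N21ChartExponentCoercivityAxialComb

end
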